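import Summits.QuantumFields.YangMills.Theorems.VirialFluxGapPeriodicSoftnessOfEulerFieldFix
import Summits.QuantumFields.YangMills.Theorems.SwapVirialDeficitToronSoftnessSharpOfPeriodicSoftnessEps
import HarnessLib

/-!
# The `∀δ` Gibbs-mean window bound (P) `b⟨F₀⟩_b ≤ 9L⁴ − 3/2 + δ` from a FAMILY of Euler fields on `X_fix` with the SHARP divergence count
# `18L⁴ − 3 + δ` — the socket of the virial road to ⟨24196⟩ `ToronSoftnessSharp` (LEAD ym-line-sfw-p2 g97, free hands; cell ym-idea-1;
# `--supports stmt-QuantumFields-24196`)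

WHY.  ✓`TreeGaugeTransfer.periodicSoftness_of_eulerFieldFix` (w2 g51, after w3 g58) turns ONE Euler field per `L` with divergence `≤ 18L⁴ − 2c₁`
and drive `≥ 2(1−ε)F − E` into `PeriodicSoftness` with `c = c₁/2`; the ⟨24141⟩ programme ran it with the resolvent + central field and got `c = 7/64`.
Its two divergence counts are NOT sharp for bookkeeping reasons only: the central budget IS `18L⁴ − 3 + 12ρ′²` (✓`centralDiv_le_budget`, used via the
corollary `≤ 18L⁴ − ½`), the generic count `½(#ι − 4)` (✓`fix_generic_divergence_upper`) uses four sheet kernel vectors where the regular valley has SIX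
(four angles + the two global conjugations transverse to the common axis), and the closing algebra ✓`mean_le_of_virial` halves `c₁`.  The target of a
sharp rerun is therefore the statement proved here: ★★★ `gibbsMeanWindow_of_eulerFieldFixFamily` — if for EVERY `δ > 0` and all large `L` there is
a field package «EulerFieldFix» (w3's letters verbatim) with `ε·L⁴ ≤ δ` and `Σ_j Dφ_j ≤ 18L⁴ − 3 + δ`, then (P): for every `δ′ > 0`, on a window
`L₀ ≤ L ≤ β^a`, `β ≥ β₀`, the Gibbs mean of the zero-flux ring deficit obeys `β·⟨F₀⟩_β ≤ 9L⁴ − 3/2 + δ′` — exactly the hypothesis of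
✓`SectorMixture.toronSoftnessSharp_of_gibbsMeanWindow` (⟨24196⟩ by name) and, with the σ-side laws, of
✓`SectorMixture.swapMeanActionGap_of_gibbsMeanWindow_of_sharpSectorLaplace` (⟨24194⟩ by name).
* §1 `mean_le_of_virial_sharp` — `2(1−ε)M ≤ 18Λ⁴ − 3 + δ + τ`, `τ ≤ δ`, `εΛ⁴ ≤ δ`, `0 ≤ ε ≤ 1/4`, `δ ≤ 1` ⟹ `M ≤ 9Λ⁴ − 3/2 + 13δ`;
* §2 ★★★ `gibbsMeanWindow_of_eulerFieldFixFamily` (proof = `periodicSoftness_of_eulerFieldFix`'s with `c₁ := 4δ` in ✓`tail_le`, §1, and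
  ✓`gibbsMean_eq_fix`; window of ✓`stub_windowArithmeticZero K q 1`);
* §3 ★★★ `toronSoftnessSharp_of_eulerFieldFixFamily` — the same family ⟹ ⟨24196⟩ `ToronSoftnessSharp` BY NAME (✓`toronSoftnessSharp_of_gibbsMeanWindow`).
HONEST LABEL: a REDUCTION; no Euler field is constructed here; the sharp rerun ((U1) sharp central budget, (U3) six kernel vectors, (U5) this algebra) is
OPEN; ⟨24196⟩ ∕ ⟨24194⟩ ∕ ⟨24197⟩ OPEN; own crux ⟨22884⟩ OPEN (blocked-on ⟨19935⟩); the Yang–Mills mass gap is NOT proved; no summit is proved by a line.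
THEOREMS ONLY (0 `def`, 0 `sorry`), standard axioms.  References: [cite: Griffiths1964]; [cite: Luscher1983, §2]; [cite: CosteEtAl1985].
-/

set_option autoImplicit false

noncomputable section

open MeasureTheory Set Filter Metric
open scoped Topology BigOperators
open Literature.MathematicalPhysics.QuantumFieldTheory hiding SU2
open Literature.MathematicalPhysics.QuantumLattice

namespace Summit.QuantumFields.YangMills.Theorems.VirialFluxGap.TreeGaugeTransfer

open Summit.QuantumFields.YangMills.Theorems.FemtoTransferGap
open Summit.QuantumFields.YangMills.Theorems.FemtoTransferGap.TT
open Summit.QuantumFields.YangMills.Theorems.VirialFluxGap.RingDeficit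
open Summit.QuantumFields.YangMills.Theorems.VirialFluxGap.EulerFieldReduction (tail_le)
open Summit.QuantumFields.YangMills.Theorems.VirialFluxGapPeriodicSoftnessWindow (stub_windowArithmeticZero)

/-! ## §1 The sharp mean algebra -/

/-- ★ From `M ≤ (18Λ⁴ − 3 + δ + τ)/(2(1−ε))` with `τ ≤ δ`, `0 ≤ M`, `0 ≤ ε ≤ 1/4`, `εΛ⁴ ≤ δ`, `δ ≤ 1`: `M ≤ 9Λ⁴ − 3/2 + 13δ`
(the sharp replacement of ✓`mean_le_of_virial`, which concludes `9Λ⁴ − c₁/2` from `18Λ⁴ − 2c₁`). [folklore] -/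
theorem mean_le_of_virial_sharp {M Λ δ ε τ : ℝ} (hM0 : 0 ≤ M) (hε0 : 0 ≤ ε) (hε : ε ≤ 1 / 4) (hεΛ : ε * Λ ^ 4 ≤ δ)
    (hδ1 : δ ≤ 1) (hτ : τ ≤ δ) (h : M ≤ (18 * Λ ^ 4 - 3 + δ + τ) / (2 * (1 - ε))) : M ≤ 9 * Λ ^ 4 - 3 / 2 + 13 * δ := by
  have h2 : 0 < 2 * (1 - ε) := by linarith
  have h1 : M * (2 * (1 - ε)) ≤ 18 * Λ ^ 4 - 3 + δ + τ := (le_div_iff₀ h2).1 h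
  have hΛ4 : 0 ≤ Λ ^ 4 := by positivity
  have hM12 : M ≤ 12 * Λ ^ 4 := by nlinarith
  have hεM : ε * M ≤ 12 * (ε * Λ ^ 4) := by nlinarith
  nlinarith

/-! ## §2 The reduction -/

/-- ★★★ **(P) FROM A `δ`-FAMILY OF EULER FIELDS ON `X_fix` WITH THE SHARP COUNT `18L⁴ − 3 + δ`.**  Hypothesis: for every `δ > 0` there are
`K ≥ 1`, `q ≥ 0`, `L₀` and, for every `L ≥ L₀`, w3's «EulerFieldFix» package (curves `γ_j` through `1`, bounded measurable coefficients `φ_j`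
differentiable along their curves, derivatives `DF_j` of the reduced deficit, an error `0 ≤ E ≤ KL^q` vanishing on `{F_fix < (KL^q)⁻¹}`) with
`0 ≤ ε ≤ 1/4`, `ε·L⁴ ≤ δ`, DRIVE `Σ_j φ_j·DF_j ≥ 2(1−ε)F_fix − E` and DIVERGENCE `Σ_j Dφ_j ≤ 18L⁴ − 3 + δ`.  Conclusion (P): for every `δ′ > 0`
there are `a > 0`, `β₀`, `L₀′` with `β·∫F₀e^{−βF₀}dμ_L ∕ ∫e^{−βF₀}dμ_L ≤ 9L⁴ − 3/2 + δ′` for `β ≥ β₀`, `L₀′ ≤ L ≤ β^a`.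
[cite: Griffiths1964] [cite: Luscher1983, §2] -/
theorem gibbsMeanWindow_of_eulerFieldFixFamily
    (hE : ∀ δ : ℝ, 0 < δ → ∃ K : ℝ, 1 ≤ K ∧ ∃ q : ℝ, 0 ≤ q ∧ ∃ L₀ : ℕ, ∀ (L : ℕ) [NeZero L], L₀ ≤ L →
      ∃ (n : ℕ) (γ : Fin n → ℝ → (OffIdx L → SU2) × ((Fin (2 * L - 1) → GaugeConfig 3 L SU2) × (Site 3 L → SU2)))
        (φ : Fin n → (OffIdx L → SU2) × ((Fin (2 * L - 1) → GaugeConfig 3 L SU2) × (Site 3 L → SU2)) → ℝ)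
        (Dφ DF : Fin n → ℝ → (OffIdx L → SU2) × ((Fin (2 * L - 1) → GaugeConfig 3 L SU2) × (Site 3 L → SU2)) → ℝ)
        (E : (OffIdx L → SU2) × ((Fin (2 * L - 1) → GaugeConfig 3 L SU2) × (Site 3 L → SU2)) → ℝ) (ε ε₀ B : ℝ),
        (∀ j, γ j 0 = 1) ∧ (∀ j, Measurable (φ j)) ∧ (∀ j x, |φ j x| ≤ B) ∧ 0 < ε₀ ∧
        (∀ j x, ∀ t ∈ Metric.ball (0 : ℝ) ε₀, HasDerivAt (fun s => φ j (x * γ j s)) (Dφ j t x) t) ∧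
        (∀ j x, ∀ t ∈ Metric.ball (0 : ℝ) ε₀,
          HasDerivAt (fun s => ringDeficit L (fun _ => false)
            ((Fin.cons (glue (x * γ j s).1) (x * γ j s).2.1 : Fin (2 * L - 1 + 1) → GaugeConfig 3 L SU2), (x * γ j s).2.2))
            (DF j t x) t) ∧
        (∀ j x, ∀ t ∈ Metric.ball (0 : ℝ) ε₀, |Dφ j t x| ≤ B) ∧ (∀ j x, ∀ t ∈ Metric.ball (0 : ℝ) ε₀, |DF j t x| ≤ B) ∧
        (∀ j, StronglyMeasurable (Dφ j 0)) ∧ (∀ j, StronglyMeasurable (DF j 0)) ∧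
        Measurable E ∧ (∀ x, 0 ≤ E x) ∧ (∀ x, E x ≤ K * (L : ℝ) ^ q) ∧
        (∀ x, ringDeficit L (fun _ => false)
          ((Fin.cons (glue x.1) x.2.1 : Fin (2 * L - 1 + 1) → GaugeConfig 3 L SU2), x.2.2) < (K * (L : ℝ) ^ q)⁻¹ → E x = 0) ∧
        0 ≤ ε ∧ ε ≤ 1 / 4 ∧ ε * (L : ℝ) ^ 4 ≤ δ ∧
        (∀ x, 2 * (1 - ε) * ringDeficit L (fun _ => false)
            ((Fin.cons (glue x.1) x.2.1 : Fin (2 * L - 1 + 1) → GaugeConfig 3 L SU2), x.2.2) - E x ≤ ∑ j, φ j x * DF j 0 x) ∧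
        (∀ x, ∑ j, Dφ j 0 x ≤ 18 * (L : ℝ) ^ 4 - 3 + δ)) :
    ∀ δ' : ℝ, 0 < δ' → ∃ a : ℝ, 0 < a ∧ ∃ β₀ : ℝ, ∃ L₀ : ℕ, ∀ β : ℝ, β₀ ≤ β → ∀ (L : ℕ) [NeZero L], L₀ ≤ L → (L : ℝ) ≤ β ^ a →
      β * (∫ p, ringDeficit L (fun _ => false) p * Real.exp (-(β * ringDeficit L (fun _ => false) p)) ∂(ringMeasure L)) /
          (∫ p, Real.exp (-(β * ringDeficit L (fun _ => false) p)) ∂(ringMeasure L)) ≤ 9 * (L : ℝ) ^ 4 - 3 / 2 + δ' := by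
  intro δ' hδ'
  -- the working precision `δ = min (δ'/13) 1`
  set δ : ℝ := min (δ' / 13) 1 with hδdef
  have hδ0 : 0 < δ := lt_min (by linarith) one_pos
  have hδ1 : δ ≤ 1 := min_le_right _ _
  have hδ13 : 13 * δ ≤ δ' := by
    have : δ ≤ δ' / 13 := min_le_left _ _
    linarith
  obtain ⟨K, hK, q, hq, L₀, hfield⟩ := hE δ hδ0
  have hK0 : 0 < K := by linarith
  obtain ⟨a, ha, β₀, hW⟩ := stub_windowArithmeticZero K q 1 hK0 hq one_pos le_rfl
  -- `tail_le` with `c₁ := 4δ` needs `log(4/(4δ)) ≤ L⁸`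
  have hc₁ : 0 < 4 * δ := by linarith
  obtain ⟨L₁, hL₁⟩ : ∃ L₁ : ℕ, Real.log (4 / (4 * δ)) ≤ L₁ := exists_nat_ge _
  refine ⟨a, ha, β₀, max L₀ L₁, fun β hβ L _ hL hLβ => ?_⟩
  have hL0 : L₀ ≤ L := le_trans (le_max_left _ _) hL
  have hLL₁ : L₁ ≤ L := le_trans (le_max_right _ _) hL
  have hL1 : 1 ≤ L := NeZero.one_le
  have hL1r : (1 : ℝ) ≤ L := by exact_mod_cast hL1
  have hw : |(0 : ℝ)| ≤ K * (L : ℝ) ^ q := by rw [abs_zero]; positivity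
  obtain ⟨hβ2, -, hthr, -⟩ := hW β hβ L hL1 hLβ 0 hw
  have hβ0 : 0 ≤ β := by linarith
  obtain ⟨n, γ, φ, Dφ, DF, E, ε, ε₀, B, hγ, hφm, hφb, hε₀, hDφ, hDF, hDφb, hDFb, hDφm, hDFm, hEm, hE0, hEle, hEsupp,
    hε0, hε4, hεL, hXF, hdiv⟩ := hfield L hL0
  set T : ℝ := K * (L : ℝ) ^ q with hT
  have hT1 : 1 ≤ T := by
    have : (1 : ℝ) ≤ (L : ℝ) ^ q := Real.one_le_rpow hL1r hq
    nlinarith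
  have hT0 : 0 < T := by linarith
  have ht₁ : 0 < T⁻¹ := inv_pos.2 hT0
  have ht₁2 : T⁻¹ ≤ 2 := by rw [inv_le_comm₀ hT0 (by norm_num)]; linarith
  have hEb : ∀ x, |E x| ≤ T := fun x => by rw [abs_of_nonneg (hE0 x)]; exact hEle x
  -- the β-explicit virial mean bound on `X_fix`
  have h1 := fix_virial_gibbsMean_le (L := L) (Finset.univ : Finset (Fin n)) (fun j _ => hγ j) (fun j _ => hφm j)
    (Cφ := fun _ => B) (fun j _ x => hφb j x) hε₀ (fun j _ x t ht => hDφ j x t ht) (fun j _ x t ht => hDF j x t ht)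
    (Bφ := fun _ => B) (BF := fun _ => B) (fun j _ x t ht => hDφb j x t ht) (fun j _ x t ht => hDFb j x t ht)
    (fun j _ => hDφm j) (fun j _ => hDFm j) hβ0 hEm hEb (D := 18 * (L : ℝ) ^ 4 - 3 + δ) (by linarith : ε < 1) hXF hdiv
  have h2 := fix_gibbsMean_error_le (L := L) hβ0 ht₁ ht₁2 hT0.le hEle hEsupp
  have h3 : 0 < 2 * (1 - ε) := by linarith
  have h4 : 18 * (L : ℝ) ^ 4 - 3 + δ + β * (∫ x, E x * Real.exp (-(β * ringDeficit L (fun _ => false)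
          ((Fin.cons (glue x.1) x.2.1 : Fin (2 * L - 1 + 1) → GaugeConfig 3 L SU2), x.2.2)))
        ∂((Measure.pi fun _ : OffIdx L => haarProbability SU2).prod
          ((Measure.pi fun _ : Fin (2 * L - 1) => configMeasure SU2 L).prod (gaugeMeasure L)))) /
        (∫ x, Real.exp (-(β * ringDeficit L (fun _ => false)
            ((Fin.cons (glue x.1) x.2.1 : Fin (2 * L - 1 + 1) → GaugeConfig 3 L SU2), x.2.2)))
          ∂((Measure.pi fun _ : OffIdx L => haarProbability SU2).prod
            ((Measure.pi fun _ : Fin (2 * L - 1) => configMeasure SU2 L).prod (gaugeMeasure L)))) ≤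
      18 * (L : ℝ) ^ 4 - 3 + δ + β * (T * Real.exp (-(β * T⁻¹ / 2) + 150 * (L : ℝ) ^ 5 * (1 + Real.log (2 / T⁻¹)))) := by
    have h5 := mul_le_mul_of_nonneg_left h2 hβ0
    rw [mul_div_assoc]
    linarith
  have hvir := h1.trans (div_le_div_of_nonneg_right h4 h3.le)
  -- the tail `≤ (4δ)/4 = δ`
  have hlogL : Real.log (4 / (4 * δ)) ≤ (L : ℝ) ^ 8 := by
    have h8 : (L : ℝ) ≤ (L : ℝ) ^ 8 := by
      calc (L : ℝ) = (L : ℝ) ^ 1 := (pow_one _).symm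
        _ ≤ (L : ℝ) ^ 8 := pow_le_pow_right₀ hL1r (by norm_num)
    exact hL₁.trans ((Nat.cast_le.2 hLL₁).trans h8)
  have hthr' : 64 * (9 * (L : ℝ) ^ 4 - 3 / 2 + 2) ^ 2 * (1 + 2 * Real.log T + Real.log β) ≤ β * T⁻¹ := by
    have hlogT : |Real.log T⁻¹| = Real.log T := by
      rw [Real.log_inv, abs_neg, abs_of_nonneg (Real.log_nonneg hT1)]
    have h := hthr
    rw [abs_zero, hlogT] at h
    linarith
  have htail := tail_le hβ2 hT1 hL1r hc₁ hlogL hthr'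
  have htail' : β * (T * Real.exp (-(β * T⁻¹ / 2) + 150 * (L : ℝ) ^ 5 * (1 + Real.log (2 / T⁻¹)))) ≤ δ := by linarith
  -- the mean bound on `X_fix`, transferred to `Ω`, and the sharp algebra
  have hM0 : 0 ≤ β * (∫ p, ringDeficit L (fun _ => false) p * Real.exp (-(β * ringDeficit L (fun _ => false) p)) ∂(ringMeasure L)) /
      (∫ p, Real.exp (-(β * ringDeficit L (fun _ => false) p)) ∂(ringMeasure L)) := by
    refine div_nonneg (mul_nonneg hβ0 (integral_nonneg fun x => ?_)) (integral_exp_neg_mul_ringDeficit_pos (L := L) β _).le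
    exact mul_nonneg (ringDeficit_nonneg _ x) (Real.exp_pos _).le
  rw [← gibbsMean_eq_fix (L := L) hβ0] at hvir
  have hmean := mean_le_of_virial_sharp hM0 hε0 hε4 hεL hδ1 htail' hvir
  linarith [hmean]

/-! ## §3 The crux by name from the family -/

/-- ★★★ **A `δ`-FAMILY OF SHARP EULER FIELDS ON `X_fix` GIVES ⟨24196⟩ `ToronSoftnessSharp` BY NAME** (§2 ∘ ✓`toronSoftnessSharp_of_gibbsMeanWindow`:
sector mixture, proved flux suppression, proved twisted two-sided equipartition).  The family is the OPEN input. [cite: Luscher1983, §2] [cite: Griffiths1964] -/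
theorem toronSoftnessSharp_of_eulerFieldFixFamily
    (hE : ∀ δ : ℝ, 0 < δ → ∃ K : ℝ, 1 ≤ K ∧ ∃ q : ℝ, 0 ≤ q ∧ ∃ L₀ : ℕ, ∀ (L : ℕ) [NeZero L], L₀ ≤ L →
      ∃ (n : ℕ) (γ : Fin n → ℝ → (OffIdx L → SU2) × ((Fin (2 * L - 1) → GaugeConfig 3 L SU2) × (Site 3 L → SU2)))
        (φ : Fin n → (OffIdx L → SU2) × ((Fin (2 * L - 1) → GaugeConfig 3 L SU2) × (Site 3 L → SU2)) → ℝ)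
        (Dφ DF : Fin n → ℝ → (OffIdx L → SU2) × ((Fin (2 * L - 1) → GaugeConfig 3 L SU2) × (Site 3 L → SU2)) → ℝ)
        (E : (OffIdx L → SU2) × ((Fin (2 * L - 1) → GaugeConfig 3 L SU2) × (Site 3 L → SU2)) → ℝ) (ε ε₀ B : ℝ),
        (∀ j, γ j 0 = 1) ∧ (∀ j, Measurable (φ j)) ∧ (∀ j x, |φ j x| ≤ B) ∧ 0 < ε₀ ∧
        (∀ j x, ∀ t ∈ Metric.ball (0 : ℝ) ε₀, HasDerivAt (fun s => φ j (x * γ j s)) (Dφ j t x) t) ∧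
        (∀ j x, ∀ t ∈ Metric.ball (0 : ℝ) ε₀,
          HasDerivAt (fun s => ringDeficit L (fun _ => false)
            ((Fin.cons (glue (x * γ j s).1) (x * γ j s).2.1 : Fin (2 * L - 1 + 1) → GaugeConfig 3 L SU2), (x * γ j s).2.2))
            (DF j t x) t) ∧
        (∀ j x, ∀ t ∈ Metric.ball (0 : ℝ) ε₀, |Dφ j t x| ≤ B) ∧ (∀ j x, ∀ t ∈ Metric.ball (0 : ℝ) ε₀, |DF j t x| ≤ B) ∧
        (∀ j, StronglyMeasurable (Dφ j 0)) ∧ (∀ j, StronglyMeasurable (DF j 0)) ∧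
        Measurable E ∧ (∀ x, 0 ≤ E x) ∧ (∀ x, E x ≤ K * (L : ℝ) ^ q) ∧
        (∀ x, ringDeficit L (fun _ => false)
          ((Fin.cons (glue x.1) x.2.1 : Fin (2 * L - 1 + 1) → GaugeConfig 3 L SU2), x.2.2) < (K * (L : ℝ) ^ q)⁻¹ → E x = 0) ∧
        0 ≤ ε ∧ ε ≤ 1 / 4 ∧ ε * (L : ℝ) ^ 4 ≤ δ ∧
        (∀ x, 2 * (1 - ε) * ringDeficit L (fun _ => false)
            ((Fin.cons (glue x.1) x.2.1 : Fin (2 * L - 1 + 1) → GaugeConfig 3 L SU2), x.2.2) - E x ≤ ∑ j, φ j x * DF j 0 x) ∧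
        (∀ x, ∑ j, Dφ j 0 x ≤ 18 * (L : ℝ) ^ 4 - 3 + δ)) :
    Summit.QuantumFields.YangMills.Theses.SwapVirialDeficit.ToronSoftnessSharp :=
  Summit.QuantumFields.YangMills.Theorems.SwapVirialDeficit.SectorMixture.toronSoftnessSharp_of_gibbsMeanWindow
    (gibbsMeanWindow_of_eulerFieldFixFamily hE)

end Summit.QuantumFields.YangMills.Theorems.VirialFluxGap.TreeGaugeTransfer

end
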